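import Mathlib
import Summits.MatrixMultiplication.MatrixMultiplication.Theorems.LieRankDesigns.Negative.Basics
import Summits.MatrixMultiplication.MatrixMultiplication.Theorems.LevelGradedCohnUmansLieRankDesignsStubLevelOneBudget
import Summits.MatrixMultiplication.MatrixMultiplication.Theorems.LevelGradedCohnUmansLieRankDesignsStubSharpLevelDegree

/-!
# `LieRankDesigns` (stmt-MatrixMultiplication-7614), line `Sketch`: the universality glue
(stubs `stub_nearWallTransfer`, `stub_fixedCellTransfer`, `stub_familyTransfer`)

Crux `Summit.MatrixMultiplication.MatrixMultiplication.Theses.LevelGradedCohnUmans.LieRankDesigns`; skeleton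
`Cruxes/LieRankDesigns/Lines/Sketch.lean`; this file proves the three registered TRANSFER stubs verbatim
(name + signature) and lands `--supports stmt-MatrixMultiplication-7614`.  They are the `ε`-bookkeeping that
turns a DESIGN hypothesis (one of the open design stubs G'' / G / G' of the line, taken here as a HYPOTHESIS and
never asserted) into the crux, using only the landed representation theory:

* `stub_nearWallTransfer` : near-wall designs (G'': for every loss `δ > 0` some cell `(m,k)`, `1 ≤ k ≤ m`, carries
  along unboundedly many primes rank-`≤ k`-separated triples with `|X||Y||Z| ≥ p^{3mk - 3k²/2 - δ}`) `→` crux.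
  Unconditional: with `s = 2+ε`, `δ := 3ε/(8s)`, `e = mk - k²/2`, the landed cell budget `cellBudget_of_stubs`
  (`budget p m k s · (p-1)^{(s-2)/2} ≤ 2^{m(s-1)} p^{es}`) gives `budget ≤ 2^{m(s-1)+ε/2} p^{es-ε/2}` while
  `V^{s/3} ≥ p^{es-ε/8}`; any prime with `p^{3ε/8} > 2^{m(s-1)+ε/2}` works.
* `stub_fixedCellTransfer` : fixed-cell saturation (G: one cell, constant factor `c₀`) `→` crux, through
  `G ⇒ G''` (`c₀ ≥ p^{-δ}` for `p` large).
* `stub_familyTransfer` : Green's degree bound (named fact H, hypothesis) `→` family saturation (G': loss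
  `p^{δk}`) `→` crux: H gives the sharp level degree (`stub_sharpLevelDegree`, landed), hence the sharp cell
  budget `budget_s ≤ 2^{(m+k)(s-2)+m} p^{(2mk-k²)+(s-2)(mk-k²/2-k/2)}`, whose Harish-Chandra slack `p^{εk/2}` beats
  the loss `p^{εk/4}` of G' at `δ := 3ε/(4s)`.

All helpers live in `namespace Universality`; every hypothesis is spelled out in the tree vocabulary of
`Theorems/LieRankDesigns/Negative/Basics.lean` (`GLm`, `RankSep`, `levelSet`, `budget`, `volume`;
`lieRankDesigns_iff` is `Iff.rfl`), no `Prop` abbreviations.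
-/

set_option linter.dupNamespace false

noncomputable section

open scoped BigOperators
open Literature.RepresentationTheory.FiniteGroups
open Summit.MatrixMultiplication.MatrixMultiplication.Theorems.LieRankDesigns.Negative
  (GLm Mat fourierFn RankSupp RankSep levelSet budget volume lieRankDesigns_iff)

namespace Summit.MatrixMultiplication.MatrixMultiplication.Theorems.LieRankDesigns

namespace Universality

/-- **The unconditional transfer from near-wall designs** (G''), given the cell budget
`budget p m k s · (p-1)^{(s-2)/2} ≤ 2^{m(s-1)} p^{(mk-k²/2)s}` (`1 ≤ k ≤ m`, `s ≥ 2`): with `s = 2+ε`,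
`δ := 3ε/(8s)` and `e = mk - k²/2`, the budget is `≤ 2^{m(s-1)} p^{es} (p-1)^{-ε/2} ≤ 2^{m(s-1)+ε/2} p^{es-ε/2}`
while `V^{s/3} ≥ p^{es - ε/8}`; any prime with `p^{3ε/8} > 2^{m(s-1)+ε/2}` works. -/
theorem lieRankDesigns_of_cellBudget_of_nearWall
    (hB : ∀ (p m k : ℕ) [Fact p.Prime], 1 ≤ k → k ≤ m → ∀ s : ℝ, 2 ≤ s →
      budget p m k s * ((p : ℝ) - 1) ^ ((s - 2) / 2) ≤
        2 ^ ((m : ℝ) * (s - 1)) * (p : ℝ) ^ (((m : ℝ) * k - (k : ℝ) ^ 2 / 2) * s))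
    (hS : ∀ δ : ℝ, 0 < δ → ∃ m k : ℕ, 1 ≤ k ∧ k ≤ m ∧ ∀ p₀ : ℕ, ∃ (p : ℕ) (_ : Fact p.Prime), p₀ ≤ p ∧
      ∃ X Y Z : Finset (GLm p m), RankSep k X Y Z ∧
        (p : ℝ) ^ (3 * (m : ℝ) * k - 3 / 2 * (k : ℝ) ^ 2 - δ) ≤ volume X Y Z) :
    ∀ ε : ℝ, 0 < ε → ∃ (p : ℕ) (_ : Fact p.Prime) (m k : ℕ) (X Y Z : Finset (GLm p m)),
      RankSep k X Y Z ∧ budget p m k (2 + ε) < volume X Y Z ^ ((2 + ε) / 3) := by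
  intro ε hε
  set s : ℝ := 2 + ε with hs_def
  have hs2 : 2 ≤ s := by rw [hs_def]; linarith
  have hs0 : 0 < s := by linarith
  -- loss rate δ := 3ε/(8s), so that δ s / 3 = ε / 8
  set δ : ℝ := 3 * ε / (8 * s) with hδ_def
  have hδ : 0 < δ := by rw [hδ_def]; positivity
  obtain ⟨m, k, hk, hkm, hall⟩ := hS δ hδ
  -- constant to beat: K := 2^{m(s-1) + ε/2}; need p^{3ε/8} > K
  set K : ℝ := 2 ^ ((m : ℝ) * (s - 1) + ε / 2) with hK_def
  have hK : 0 < K := by rw [hK_def]; positivity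
  have hexp0 : 0 < 3 * ε / 8 := by positivity
  obtain ⟨N, hN⟩ := exists_nat_gt (K ^ (1 / (3 * ε / 8)) + 2)
  obtain ⟨p, hprime, hNp, X, Y, Z, hsep, hvol⟩ := hall N
  refine ⟨p, hprime, m, k, X, Y, Z, hsep, ?_⟩
  have hp2 : 2 ≤ p := hprime.out.two_le
  have hpR : (2 : ℝ) ≤ p := by exact_mod_cast hp2
  have hp0 : (0 : ℝ) < p := by linarith
  have hq0 : (0 : ℝ) < (p : ℝ) - 1 := by linarith
  have hNR : (N : ℝ) ≤ p := by exact_mod_cast hNp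
  have hKp : K < (p : ℝ) ^ (3 * ε / 8) := by
    have h1 : K ^ (1 / (3 * ε / 8)) < p := by linarith
    have h2 : (K ^ (1 / (3 * ε / 8))) ^ (3 * ε / 8) < (p : ℝ) ^ (3 * ε / 8) :=
      Real.rpow_lt_rpow (by positivity) h1 hexp0
    have h3 : (K ^ (1 / (3 * ε / 8))) ^ (3 * ε / 8) = K := by
      rw [← Real.rpow_mul hK.le]
      have : (1 / (3 * ε / 8)) * (3 * ε / 8) = 1 := by field_simp
      rw [this, Real.rpow_one]
    rwa [h3] at h2
  -- budget side
  set e : ℝ := (m : ℝ) * k - (k : ℝ) ^ 2 / 2 with he_def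
  have hbud := hB p m k hk hkm s hs2
  have hexp : (s - 2) / 2 = ε / 2 := by rw [hs_def]; ring
  rw [hexp] at hbud
  have hqpow : 0 < ((p : ℝ) - 1) ^ (ε / 2) := Real.rpow_pos_of_pos hq0 _
  have hbud' : budget p m k s ≤ 2 ^ ((m : ℝ) * (s - 1)) * (p : ℝ) ^ (e * s) / ((p : ℝ) - 1) ^ (ε / 2) := by
    rw [le_div_iff₀ hqpow]; exact hbud
  -- (p-1)^{ε/2} ≥ p^{ε/2} / 2^{ε/2}
  have hhalf : (p : ℝ) / 2 ≤ (p : ℝ) - 1 := by linarith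
  have hq1 : (p : ℝ) ^ (ε / 2) / 2 ^ (ε / 2) ≤ ((p : ℝ) - 1) ^ (ε / 2) := by
    rw [← Real.div_rpow hp0.le (by norm_num : (0:ℝ) ≤ 2)]
    exact Real.rpow_le_rpow (by positivity) hhalf (by positivity)
  have hpe2 : 0 < (p : ℝ) ^ (ε / 2) / 2 ^ (ε / 2) := by positivity
  have hbud'' : budget p m k s ≤ K * (p : ℝ) ^ (e * s - ε / 2) := by
    calc budget p m k s ≤ 2 ^ ((m : ℝ) * (s - 1)) * (p : ℝ) ^ (e * s) / ((p : ℝ) - 1) ^ (ε / 2) := hbud'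
      _ ≤ 2 ^ ((m : ℝ) * (s - 1)) * (p : ℝ) ^ (e * s) / ((p : ℝ) ^ (ε / 2) / 2 ^ (ε / 2)) :=
          div_le_div_of_nonneg_left (by positivity) hpe2 hq1
      _ = K * (p : ℝ) ^ (e * s - ε / 2) := by
          rw [hK_def, Real.rpow_add (by norm_num : (0:ℝ) < 2), Real.rpow_sub hp0]
          field_simp
  -- volume side: V^{s/3} ≥ p^{es - ε/8}
  have hV3 : 3 * (m : ℝ) * k - 3 / 2 * (k : ℝ) ^ 2 - δ = 3 * e - δ := by rw [he_def]; ring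
  rw [hV3] at hvol
  have hV0 : 0 ≤ volume X Y Z := by unfold volume; positivity
  have hlow : ((p : ℝ) ^ (3 * e - δ)) ^ (s / 3) ≤ volume X Y Z ^ (s / 3) :=
    Real.rpow_le_rpow (by positivity) hvol (by positivity)
  have hδs : (3 * e - δ) * (s / 3) = e * s - ε / 8 := by
    rw [hδ_def]; field_simp
  have hlow' : ((p : ℝ) ^ (3 * e - δ)) ^ (s / 3) = (p : ℝ) ^ (e * s - ε / 8) := by
    rw [← Real.rpow_mul hp0.le, hδs]
  -- compare: K p^{es - ε/2} < p^{3ε/8} p^{es - ε/2} = p^{es - ε/8}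
  have hmid : K * (p : ℝ) ^ (e * s - ε / 2) < (p : ℝ) ^ (e * s - ε / 8) := by
    have hpos : 0 < (p : ℝ) ^ (e * s - ε / 2) := Real.rpow_pos_of_pos hp0 _
    calc K * (p : ℝ) ^ (e * s - ε / 2)
        < (p : ℝ) ^ (3 * ε / 8) * (p : ℝ) ^ (e * s - ε / 2) := mul_lt_mul_of_pos_right hKp hpos
      _ = (p : ℝ) ^ (e * s - ε / 8) := by
          rw [← Real.rpow_add hp0]; congr 1; ring
  have hdiv : (2 + ε) / 3 = s / 3 := by rw [hs_def]
  rw [hdiv]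
  calc budget p m k s ≤ K * (p : ℝ) ^ (e * s - ε / 2) := hbud''
    _ < (p : ℝ) ^ (e * s - ε / 8) := hmid
    _ = ((p : ℝ) ^ (3 * e - δ)) ^ (s / 3) := hlow'.symm
    _ ≤ volume X Y Z ^ (s / 3) := hlow

/-- **G ⇒ G''**: fixed-cell saturation with a constant factor `c₀ > 0` at one cell `(m, k)` gives near-wall
designs for every loss `δ > 0` at the same cell (`c₀ ≥ p^{-δ}` for `p` large). -/
theorem nearWallDesigns_of_fixedCell
    (hG : ∃ m k : ℕ, 1 ≤ k ∧ k ≤ m ∧ ∃ c₀ : ℝ, 0 < c₀ ∧ ∀ p₀ : ℕ, ∃ (p : ℕ) (_ : Fact p.Prime), p₀ ≤ p ∧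
      ∃ X Y Z : Finset (GLm p m), RankSep k X Y Z ∧
        c₀ * (p : ℝ) ^ (3 * (m : ℝ) * k - 3 / 2 * (k : ℝ) ^ 2) ≤ volume X Y Z) :
    ∀ δ : ℝ, 0 < δ → ∃ m k : ℕ, 1 ≤ k ∧ k ≤ m ∧ ∀ p₀ : ℕ, ∃ (p : ℕ) (_ : Fact p.Prime), p₀ ≤ p ∧
      ∃ X Y Z : Finset (GLm p m), RankSep k X Y Z ∧
        (p : ℝ) ^ (3 * (m : ℝ) * k - 3 / 2 * (k : ℝ) ^ 2 - δ) ≤ volume X Y Z := by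
  intro δ hδ
  obtain ⟨m, k, hk, hkm, c₀, hc₀, hall⟩ := hG
  refine ⟨m, k, hk, hkm, fun p₀ => ?_⟩
  obtain ⟨N, hN⟩ := exists_nat_gt ((1 / c₀) ^ (1 / δ) + p₀ + 1)
  obtain ⟨p, hprime, hNp, X, Y, Z, hsep, hvol⟩ := hall N
  have hNR : (N : ℝ) ≤ p := by exact_mod_cast hNp
  have hpos1 : (0:ℝ) ≤ (1 / c₀) ^ (1 / δ) := by positivity
  have hp0 : (0 : ℝ) < p := by
    have : (0:ℝ) ≤ (p₀ : ℝ) := by positivity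
    linarith
  have hp₀p : p₀ ≤ p := by
    have : (p₀ : ℝ) ≤ p := by linarith
    exact_mod_cast this
  refine ⟨p, hprime, hp₀p, X, Y, Z, hsep, le_trans ?_ hvol⟩
  have h1 : (1 / c₀) ^ (1 / δ) < p := by
    have : (0:ℝ) ≤ (p₀ : ℝ) := by positivity
    linarith
  have h2 : 1 / c₀ < (p : ℝ) ^ δ := by
    have h := Real.rpow_lt_rpow (by positivity) h1 hδ
    rwa [← Real.rpow_mul (by positivity), show (1 / δ) * δ = 1 by field_simp, Real.rpow_one] at h
  have h3 : 1 < c₀ * (p : ℝ) ^ δ := by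
    rw [div_lt_iff₀ hc₀] at h2; linarith
  have hsplit : (p : ℝ) ^ (3 * (m : ℝ) * k - 3 / 2 * (k : ℝ) ^ 2 - δ) * (p : ℝ) ^ δ =
      (p : ℝ) ^ (3 * (m : ℝ) * k - 3 / 2 * (k : ℝ) ^ 2) := by
    rw [← Real.rpow_add hp0]; congr 1; ring
  have hq : 0 < (p : ℝ) ^ (3 * (m : ℝ) * k - 3 / 2 * (k : ℝ) ^ 2 - δ) := Real.rpow_pos_of_pos hp0 _
  calc (p : ℝ) ^ (3 * (m : ℝ) * k - 3 / 2 * (k : ℝ) ^ 2 - δ)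
      = (p : ℝ) ^ (3 * (m : ℝ) * k - 3 / 2 * (k : ℝ) ^ 2 - δ) * 1 := by ring
    _ ≤ (p : ℝ) ^ (3 * (m : ℝ) * k - 3 / 2 * (k : ℝ) ^ 2 - δ) * (c₀ * (p : ℝ) ^ δ) :=
        mul_le_mul_of_nonneg_left h3.le hq.le
    _ = c₀ * (p : ℝ) ^ (3 * (m : ℝ) * k - 3 / 2 * (k : ℝ) ^ 2) := by rw [← hsplit]; ring

/-- **The family transfer** (level pinning with the Harish-Chandra slack `p^{εk/2}`): given the sharp cell budget
`budget_s ≤ 2^{(m+k)(s-2)+m} · p^{(2mk-k²) + (s-2)(mk-k²/2-k/2)}` (`1 ≤ k ≤ m`, `s ≥ 2`) and family saturation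
(G': loss `p^{δk}`, every `δ > 0`, some cell), the crux follows: for `ε > 0` put `s = 2+ε`, `δ := 3ε/(4s)`; G'
supplies a cell `(m,k)` and primes with `V ≥ p^{3e - δk}` (`e = mk - k²/2`), so `V^{s/3} ≥ p^{es - εk/4}`, while the
budget is `≤ 2^{(m+k)ε+m} p^{es - εk/2}`; any prime with `p^{εk/4} > 2^{(m+k)ε+m}` works. -/
theorem lieRankDesigns_of_sharpCellBudget_of_family
    (hB : ∀ (p m k : ℕ) [Fact p.Prime], 1 ≤ k → k ≤ m → ∀ s : ℝ, 2 ≤ s →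
      budget p m k s ≤
        2 ^ (((m : ℝ) + k) * (s - 2) + m) *
          (p : ℝ) ^ ((2 * (m : ℝ) * k - (k : ℝ) ^ 2) + (s - 2) * ((m : ℝ) * k - (k : ℝ) ^ 2 / 2 - (k : ℝ) / 2)))
    (hS : ∀ δ : ℝ, 0 < δ → ∃ m k : ℕ, 1 ≤ k ∧ k ≤ m ∧ ∀ p₀ : ℕ, ∃ (p : ℕ) (_ : Fact p.Prime), p₀ ≤ p ∧
      ∃ X Y Z : Finset (GLm p m), RankSep k X Y Z ∧
        (p : ℝ) ^ (3 * (m : ℝ) * k - 3 / 2 * (k : ℝ) ^ 2 - δ * k) ≤ volume X Y Z) :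
    ∀ ε : ℝ, 0 < ε → ∃ (p : ℕ) (_ : Fact p.Prime) (m k : ℕ) (X Y Z : Finset (GLm p m)),
      RankSep k X Y Z ∧ budget p m k (2 + ε) < volume X Y Z ^ ((2 + ε) / 3) := by
  intro ε hε
  set s : ℝ := 2 + ε with hs_def
  have hs2 : 2 ≤ s := by rw [hs_def]; linarith
  have hs0 : 0 < s := by linarith
  -- choose the loss rate δ = 3ε/(4s), so that δ k s / 3 = ε k / 4
  set δ : ℝ := 3 * ε / (4 * s) with hδ_def
  have hδ : 0 < δ := by rw [hδ_def]; positivity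
  obtain ⟨m, k, hk, hkm, hall⟩ := hS δ hδ
  have hkR : (1 : ℝ) ≤ k := by exact_mod_cast hk
  have hk0 : (0 : ℝ) < k := by linarith
  -- the constant to beat: C := 2^{(m+k)(s-2)+m}; need p^{εk/4} > C
  set C : ℝ := 2 ^ (((m : ℝ) + k) * (s - 2) + m) with hC_def
  have hC : 0 < C := by rw [hC_def]; positivity
  have hexp0 : 0 < ε * k / 4 := by positivity
  obtain ⟨N, hN⟩ := exists_nat_gt (C ^ (1 / (ε * k / 4)) + 2)
  obtain ⟨p, hprime, hNp, X, Y, Z, hsep, hvol⟩ := hall N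
  refine ⟨p, hprime, m, k, X, Y, Z, hsep, ?_⟩
  have hp2 : 2 ≤ p := hprime.out.two_le
  have hpR : (2 : ℝ) ≤ p := by exact_mod_cast hp2
  have hp0 : (0 : ℝ) < p := by linarith
  have hNR : (N : ℝ) ≤ p := by exact_mod_cast hNp
  -- C < p^{εk/4}
  have hCp : C < (p : ℝ) ^ (ε * k / 4) := by
    have h1 : C ^ (1 / (ε * k / 4)) < p := by linarith
    have h2 : (C ^ (1 / (ε * k / 4))) ^ (ε * k / 4) < (p : ℝ) ^ (ε * k / 4) :=
      Real.rpow_lt_rpow (by positivity) h1 hexp0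
    have h3 : (C ^ (1 / (ε * k / 4))) ^ (ε * k / 4) = C := by
      rw [← Real.rpow_mul hC.le]
      have : (1 / (ε * k / 4)) * (ε * k / 4) = 1 := by field_simp
      rw [this, Real.rpow_one]
    rwa [h3] at h2
  -- exponents
  set e : ℝ := (m : ℝ) * k - (k : ℝ) ^ 2 / 2 with he_def
  have hbud := hB p m k hk hkm s hs2
  have hE1 : (2 * (m : ℝ) * k - (k : ℝ) ^ 2) + (s - 2) * ((m : ℝ) * k - (k : ℝ) ^ 2 / 2 - (k : ℝ) / 2)
      = e * s - ε * k / 2 := by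
    rw [he_def, hs_def]; ring
  rw [hE1] at hbud
  have hV3 : 3 * (m : ℝ) * k - 3 / 2 * (k : ℝ) ^ 2 - δ * k = 3 * e - δ * k := by rw [he_def]; ring
  rw [hV3] at hvol
  have hV0 : 0 ≤ volume X Y Z := by unfold volume; positivity
  have hlow : ((p : ℝ) ^ (3 * e - δ * k)) ^ (s / 3) ≤ volume X Y Z ^ (s / 3) :=
    Real.rpow_le_rpow (by positivity) hvol (by positivity)
  have hδks : (3 * e - δ * k) * (s / 3) = e * s - ε * k / 4 := by
    rw [hδ_def]; field_simp
  have hlow' : ((p : ℝ) ^ (3 * e - δ * k)) ^ (s / 3) = (p : ℝ) ^ (e * s - ε * k / 4) := by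
    rw [← Real.rpow_mul hp0.le, hδks]
  -- split the powers of p
  have hsplit1 : (p : ℝ) ^ (e * s - ε * k / 2) = (p : ℝ) ^ (e * s - ε * k / 4) / (p : ℝ) ^ (ε * k / 4) := by
    rw [← Real.rpow_sub hp0]; congr 1; ring
  have hppos : 0 < (p : ℝ) ^ (ε * k / 4) := Real.rpow_pos_of_pos hp0 _
  have hqpos : 0 < (p : ℝ) ^ (e * s - ε * k / 4) := Real.rpow_pos_of_pos hp0 _
  have hfinal : C * (p : ℝ) ^ (e * s - ε * k / 2) < (p : ℝ) ^ (e * s - ε * k / 4) := by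
    rw [hsplit1, mul_div_assoc', div_lt_iff₀ hppos]
    calc C * (p : ℝ) ^ (e * s - ε * k / 4)
        < (p : ℝ) ^ (ε * k / 4) * (p : ℝ) ^ (e * s - ε * k / 4) := mul_lt_mul_of_pos_right hCp hqpos
      _ = (p : ℝ) ^ (e * s - ε * k / 4) * (p : ℝ) ^ (ε * k / 4) := by ring
  have hdiv : (2 + ε) / 3 = s / 3 := by rw [hs_def]
  rw [hdiv]
  calc budget p m k s
      ≤ C * (p : ℝ) ^ (e * s - ε * k / 2) := hbud
    _ < (p : ℝ) ^ (e * s - ε * k / 4) := hfinal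
    _ = ((p : ℝ) ^ (3 * e - δ * k)) ^ (s / 3) := hlow'.symm
    _ ≤ volume X Y Z ^ (s / 3) := hlow

/-- The `s = 2` wall from the cell budget: `budget p m k 2 ≤ 2^m p^{2mk - k²}`. -/
theorem wall_of_cellBudget
    (hB : ∀ (p m k : ℕ) [Fact p.Prime], 1 ≤ k → k ≤ m → ∀ s : ℝ, 2 ≤ s →
      budget p m k s * ((p : ℝ) - 1) ^ ((s - 2) / 2) ≤
        2 ^ ((m : ℝ) * (s - 1)) * (p : ℝ) ^ (((m : ℝ) * k - (k : ℝ) ^ 2 / 2) * s))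
    (p m k : ℕ) [Fact p.Prime] (hk : 1 ≤ k) (hkm : k ≤ m) :
    budget p m k 2 ≤ 2 ^ (m : ℝ) * (p : ℝ) ^ (2 * (m : ℝ) * k - (k : ℝ) ^ 2) := by
  have h := hB p m k hk hkm 2 le_rfl
  have h0 : ((2 : ℝ) - 2) / 2 = 0 := by norm_num
  rw [h0, Real.rpow_zero, mul_one] at h
  have h1 : (m : ℝ) * (2 - 1) = m := by ring
  have h2 : ((m : ℝ) * k - (k : ℝ) ^ 2 / 2) * 2 = 2 * (m : ℝ) * k - (k : ℝ) ^ 2 := by ring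
  rw [h1, h2] at h
  exact h

/-- **The sharp glue** (J): the sharp level degree `χ(1) ≤ D := 2^{m+k} p^{mk-k²/2-k/2}` on `Irr ∩ F_k` and the
cell budget give the sharp cell budget `budget_s ≤ 2^{(m+k)(s-2)+m} · p^{(2mk-k²) + (s-2)(mk-k²/2-k/2)}`:
`Σ_S d^s = Σ_S d^{s-2} d² ≤ D^{s-2} Σ_S d² = D^{s-2}·budget₂ ≤ D^{s-2} 2^m p^{2mk-k²}` (`wall_of_cellBudget`). -/
theorem sharpCellBudget_of
    (hI : ∀ (p m k : ℕ) [Fact p.Prime], 1 ≤ k → k ≤ m →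
      ∀ χ ∈ irrChars (GLm p m) ∩ levelSet p m k,
        (χ 1).re ≤ 2 ^ (m + k) * (p : ℝ) ^ ((m : ℝ) * k - (k : ℝ) ^ 2 / 2 - (k : ℝ) / 2))
    (hB : ∀ (p m k : ℕ) [Fact p.Prime], 1 ≤ k → k ≤ m → ∀ s : ℝ, 2 ≤ s →
      budget p m k s * ((p : ℝ) - 1) ^ ((s - 2) / 2) ≤
        2 ^ ((m : ℝ) * (s - 1)) * (p : ℝ) ^ (((m : ℝ) * k - (k : ℝ) ^ 2 / 2) * s)) :
    ∀ (p m k : ℕ) [Fact p.Prime], 1 ≤ k → k ≤ m → ∀ s : ℝ, 2 ≤ s →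
      budget p m k s ≤
        2 ^ (((m : ℝ) + k) * (s - 2) + m) *
          (p : ℝ) ^ ((2 * (m : ℝ) * k - (k : ℝ) ^ 2) + (s - 2) * ((m : ℝ) * k - (k : ℝ) ^ 2 / 2 - (k : ℝ) / 2)) := by
  intro p m k _ hk hkm s hs
  have hwall := wall_of_cellBudget hB p m k hk hkm
  have hp2 : 2 ≤ p := (Fact.out : p.Prime).two_le
  have hpR : (2 : ℝ) ≤ p := by exact_mod_cast hp2
  have hp0 : (0 : ℝ) < p := by linarith
  set e₁ : ℝ := (m : ℝ) * k - (k : ℝ) ^ 2 / 2 - (k : ℝ) / 2 with he₁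
  set e₂ : ℝ := 2 * (m : ℝ) * k - (k : ℝ) ^ 2 with he₂
  set D : ℝ := 2 ^ (m + k) * (p : ℝ) ^ e₁ with hD_def
  have hD0 : 0 ≤ D := by rw [hD_def]; positivity
  -- termwise: d^s ≤ D^{s-2} d^2 for χ ∈ S
  have hfin : (irrChars (GLm p m) ∩ levelSet p m k).Finite :=
    (irrChars_finite_holds (GLm p m)).subset Set.inter_subset_left
  have hterm : ∀ χ ∈ hfin.toFinset, (χ 1).re ^ s ≤ D ^ (s - 2) * (χ 1).re ^ (2 : ℝ) := by
    intro χ hχ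
    have hχ' := hfin.mem_toFinset.1 hχ
    obtain ⟨n, -, hn⟩ := IsIrrChar.exists_apply_one hχ'.1
    have hdn : (χ 1).re = n := by rw [hn]; simp
    have hd0 : 0 ≤ (χ 1).re := by rw [hdn]; positivity
    have hdD : (χ 1).re ≤ D := hI p m k hk hkm χ hχ'
    have hsplit : (χ 1).re ^ s = (χ 1).re ^ (s - 2) * (χ 1).re ^ (2 : ℝ) := by
      rw [← Real.rpow_add' hd0 (by linarith : s - 2 + 2 ≠ 0)]; congr 1; ring
    rw [hsplit]
    exact mul_le_mul_of_nonneg_right (Real.rpow_le_rpow hd0 hdD (by linarith)) (by positivity)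
  have hbud2 : budget p m k 2 = ∑ χ ∈ hfin.toFinset, (χ 1).re ^ (2 : ℝ) := by
    unfold budget; rw [finsum_mem_eq_finite_toFinset_sum _ hfin]
  have hbuds : budget p m k s = ∑ χ ∈ hfin.toFinset, (χ 1).re ^ s := by
    unfold budget; rw [finsum_mem_eq_finite_toFinset_sum _ hfin]
  -- the algebra of the constants
  have h2nat : ((2 : ℝ) ^ (m + k) : ℝ) = (2 : ℝ) ^ ((m : ℝ) + k) := by
    rw [← Real.rpow_natCast]; push_cast; ring_nf
  have hDpow : D ^ (s - 2) = 2 ^ (((m : ℝ) + k) * (s - 2)) * (p : ℝ) ^ (e₁ * (s - 2)) := by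
    rw [hD_def, Real.mul_rpow (by positivity) (by positivity), h2nat,
      ← Real.rpow_mul (by norm_num : (0:ℝ) ≤ 2), ← Real.rpow_mul hp0.le]
  have hconst : D ^ (s - 2) * (2 ^ (m : ℝ) * (p : ℝ) ^ e₂) =
      2 ^ (((m : ℝ) + k) * (s - 2) + m) * (p : ℝ) ^ (e₂ + (s - 2) * e₁) := by
    rw [hDpow, Real.rpow_add (by norm_num : (0:ℝ) < 2), Real.rpow_add hp0]
    have : e₁ * (s - 2) = (s - 2) * e₁ := by ring
    rw [this]; ring
  calc budget p m k s = ∑ χ ∈ hfin.toFinset, (χ 1).re ^ s := hbuds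
    _ ≤ ∑ χ ∈ hfin.toFinset, D ^ (s - 2) * (χ 1).re ^ (2 : ℝ) := Finset.sum_le_sum hterm
    _ = D ^ (s - 2) * budget p m k 2 := by rw [hbud2, Finset.mul_sum]
    _ ≤ D ^ (s - 2) * (2 ^ (m : ℝ) * (p : ℝ) ^ e₂) :=
        mul_le_mul_of_nonneg_left hwall (by positivity)
    _ = 2 ^ (((m : ℝ) + k) * (s - 2) + m) * (p : ℝ) ^ (e₂ + (s - 2) * e₁) := hconst

end Universality

/-- **Stub `stub_nearWallTransfer`** (registered signature): near-wall designs (the open design stub G'' of line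
`Sketch`, taken as a hypothesis) imply the crux `LieRankDesigns` — unconditionally, through the landed cell
budget `cellBudget_of_stubs` and `Universality.lieRankDesigns_of_cellBudget_of_nearWall`. -/
theorem stub_nearWallTransfer :
    (∀ δ : ℝ, 0 < δ → ∃ m k : ℕ, 1 ≤ k ∧ k ≤ m ∧ ∀ p₀ : ℕ, ∃ (p : ℕ) (_ : Fact p.Prime), p₀ ≤ p ∧
      ∃ X Y Z : Finset (GLm p m), RankSep k X Y Z ∧
        (p : ℝ) ^ (3 * (m : ℝ) * k - 3 / 2 * (k : ℝ) ^ 2 - δ) ≤ volume X Y Z) →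
      Summit.MatrixMultiplication.MatrixMultiplication.Theses.LevelGradedCohnUmans.LieRankDesigns :=
  fun hS => lieRankDesigns_iff.2
    (Universality.lieRankDesigns_of_cellBudget_of_nearWall
      (fun p m k _ hk hkm s hs => cellBudget_of_stubs p m k hk hkm s hs) hS)

/-- **Stub `stub_fixedCellTransfer`** (registered signature): fixed-cell wall saturation with a constant factor
(the open design stub G of line `Sketch`, taken as a hypothesis) implies the crux `LieRankDesigns`, through
`G ⇒ G''` (`Universality.nearWallDesigns_of_fixedCell`) and the near-wall transfer. -/
theorem stub_fixedCellTransfer :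
    (∃ m k : ℕ, 1 ≤ k ∧ k ≤ m ∧ ∃ c₀ : ℝ, 0 < c₀ ∧ ∀ p₀ : ℕ, ∃ (p : ℕ) (_ : Fact p.Prime), p₀ ≤ p ∧
      ∃ X Y Z : Finset (GLm p m), RankSep k X Y Z ∧
        c₀ * (p : ℝ) ^ (3 * (m : ℝ) * k - 3 / 2 * (k : ℝ) ^ 2) ≤ volume X Y Z) →
      Summit.MatrixMultiplication.MatrixMultiplication.Theses.LevelGradedCohnUmans.LieRankDesigns :=
  fun hG => lieRankDesigns_iff.2
    (Universality.lieRankDesigns_of_cellBudget_of_nearWall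
      (fun p m k _ hk hkm s hs => cellBudget_of_stubs p m k hk hkm s hs)
      (Universality.nearWallDesigns_of_fixedCell hG))

/-- **Stub `stub_familyTransfer`** (registered signature): Green's degree bound for `GL_n(𝔽_p)` (the named fact
H, hypothesis) and family saturation (the open design stub G' of line `Sketch`, loss `p^{δk}`, hypothesis) imply
the crux `LieRankDesigns`: H gives the sharp level degree (`stub_sharpLevelDegree`, landed), which with the cell
budget gives the sharp cell budget (`Universality.sharpCellBudget_of`), and the family transfer
`Universality.lieRankDesigns_of_sharpCellBudget_of_family` concludes. -/
theorem stub_familyTransfer :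
    (∀ (n p : ℕ) [Fact p.Prime], ∀ χ ∈ irrChars (GLm p n), (χ 1).re ≤ 2 ^ n * (p : ℝ) ^ ((n : ℝ) * (n - 1) / 2)) →
      (∀ δ : ℝ, 0 < δ → ∃ m k : ℕ, 1 ≤ k ∧ k ≤ m ∧ ∀ p₀ : ℕ, ∃ (p : ℕ) (_ : Fact p.Prime), p₀ ≤ p ∧
        ∃ X Y Z : Finset (GLm p m), RankSep k X Y Z ∧
          (p : ℝ) ^ (3 * (m : ℝ) * k - 3 / 2 * (k : ℝ) ^ 2 - δ * k) ≤ volume X Y Z) →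
        Summit.MatrixMultiplication.MatrixMultiplication.Theses.LevelGradedCohnUmans.LieRankDesigns :=
  fun hGreen hS => lieRankDesigns_iff.2
    (Universality.lieRankDesigns_of_sharpCellBudget_of_family
      (Universality.sharpCellBudget_of
        (fun p m k _ hk hkm χ hχ => stub_sharpLevelDegree hGreen p m k hk hkm χ hχ)
        (fun p m k _ hk hkm s hs => cellBudget_of_stubs p m k hk hkm s hs)) hS)

end Summit.MatrixMultiplication.MatrixMultiplication.Theorems.LieRankDesigns

end
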